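import Summits.AnomalousDissipation.AnomalousDissipation.Theorems.SoloInformedLiouvilleStates
import Mathlib.Analysis.Normed.Group.Tannery

/-!
# Liouville laminar states IV: the dissipation vanishes (solo-informed)

The Liouville laminar states `U_ν = (c, R_ν) ∘ π` of `SoloInformedLiouvilleStates` (ONE smooth
force `f`, exact steady Navier–Stokes states for every `ν > 0`, energy `≤ |c|² + 4`, enstrophy
`‖∇U_{ν_n}‖₂² → ∞` along `ν_n → 0`) carry NO anomalous dissipation:

**Theorem** (`tendsto_dissipation_UL`). `ν ‖∇U_ν‖₂² → 0` as `ν → 0⁺`, over the whole family.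

Hence (`exists_lerayHopf_unboundedMeanEnstrophy_vanishingDissipation`), in the exact vocabulary of
the zeroth law `AnomalousDissipation`: one smooth divergence-free mean-zero force, `ν_j → 0`,
global Leray–Hopf solutions with `sup_j meanEnergy < ∞`, `meanDissipation(ν_j,u_j)/ν_j → ∞`
AND `meanDissipation(ν_j,u_j) → 0`.  The necessary condition "unbounded mean enstrophy at bounded
mean energy" is therefore STRICTLY weaker than the zeroth law inside the class of exact fixed-force
Leray–Hopf families: it is met by laminar states whose dissipation tends to zero.

**Proof.** `∂ⱼR_ν = ∑_n M_{k_n}(2πi k_{n,j} z_n(ν))` termwise, so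
`|∂ⱼR_ν| ≤ ∑_n √λ_n |z_n(ν)|` pointwise (`(2π k_{n,j})² ≤ λ_n = 4π²|k_n|²`), and since the torus
has unit volume and `∇c = 0`,
`ν‖∇U_ν‖₂² = ν‖∇R_ν‖₂² ≤ 2ν (∑_n √λ_n |z_n(ν)|)² = 2 (∑_n √(νλ_n) |z_n(ν)|)²`.
Each term satisfies
`νλ_n|z_n(ν)|² = νλ_n w_n²/(σ_n² + ν²λ_n²) ≤ w_n²/(2|σ_n|)·(2|σ_n|νλ_n)/(σ_n²+ν²λ_n²)`
`≤ π s_n 4^{-n} ≤ π 4^{-n}` (AM–GM and `w_n = |σ_n| 2^{-n}`, `|σ_n| = 2πs_n < 2π`), a summable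
majorant independent of `ν`, and tends to `0` as `ν → 0⁺` (`|z_n(ν)| ≤ 2^{-n}`); Tannery's theorem
(dominated convergence for series) gives `∑_n √(νλ_n)|z_n(ν)| → 0`.

References: J. Tannery / Mathlib `tendsto_tsum_of_dominated_convergence`; L. Grafakos, *Classical
Fourier Analysis* (2014) Prop. 3.2.6 [Grafakos2014]; A. Cheskidov, arXiv:2311.04182 §6 (the
`2½`-dimensional dissipation split) [Cheskidov2023].
-/

noncomputable section

open MeasureTheory Filter Topology Set UnitAddTorus
open scoped ENNReal NNReal Real

namespace Summit.AnomalousDissipation.AnomalousDissipation.Theorems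

open Literature.Analysis.FunctionSpaces Literature.Analysis.FunctionSpaces.Torus
  Literature.Analysis.FluidPDE

/-! ## Termwise gradient amplitudes -/

section Planar


/-- `2π |k_{n,j}| ≤ √λ_n`, i.e. `(2π k_{n,j})² ≤ λ_n = 4π² |k_n|²`. [folklore] -/
theorem two_pi_mul_abs_kL_le (n : ℕ) (j : Fin 2) :
    2 * Real.pi * |(kL n j : ℝ)| ≤ Real.sqrt (lamL n) := by
  have h : ((kL n j : ℤ) : ℝ) ^ 2 ≤ freqNormSq (kL n) := by
    unfold freqNormSq
    exact Finset.single_le_sum (f := fun i => ((kL n i : ℤ) : ℝ) ^ 2) (fun i _ => sq_nonneg _)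
      (Finset.mem_univ j)
  have h2 : (2 * Real.pi * (kL n j : ℝ)) ^ 2 ≤ lamL n := by
    unfold lamL
    nlinarith [Real.pi_pos, mul_pos Real.pi_pos Real.pi_pos]
  refine Real.le_sqrt_of_sq_le ?_
  calc (2 * Real.pi * |(kL n j : ℝ)|) ^ 2 = (2 * Real.pi * (kL n j : ℝ)) ^ 2 := by
        rw [mul_pow, mul_pow (2 * Real.pi) ((kL n j : ℤ) : ℝ), sq_abs]
    _ ≤ lamL n := h2

/-- The coefficient of the `n`-th mode of `∂ⱼR_ν` is bounded by `g_n(ν)`: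
`|2πi k_{n,j} z_n(ν)| ≤ √λ_n |z_n(ν)|`. [folklore] -/
theorem norm_deriv_coeff_le (ν : ℝ) (n : ℕ) (j : Fin 2) :
    ‖2 * Real.pi * Complex.I * ((kL n j : ℤ) : ℂ) * zL ν n‖ ≤ (Real.sqrt (lamL n) * ‖zL ν n‖) := by
  have h1 : ‖2 * Real.pi * Complex.I * ((kL n j : ℤ) : ℂ) * zL ν n‖ =
      2 * Real.pi * |(kL n j : ℝ)| * ‖zL ν n‖ := by
    simp only [norm_mul, Complex.norm_real, Real.norm_eq_abs, Complex.norm_I, mul_one,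
      Complex.norm_intCast, abs_of_pos Real.pi_pos]
    norm_num
  rw [h1]
  exact mul_le_mul_of_nonneg_right (two_pi_mul_abs_kL_le n j) (norm_nonneg _)

/-- `√λ_n ≤ 2π(1 + |k_n|²)` (so the gradient amplitudes are summable by rapid decay).
[folklore] -/
theorem sqrt_lamL_le (n : ℕ) : Real.sqrt (lamL n) ≤ 2 * Real.pi * (1 + freqNormSq (kL n)) := by
  have hF := freqNormSq_nonneg (kL n)
  calc Real.sqrt (lamL n) ≤ Real.sqrt ((2 * Real.pi * (1 + freqNormSq (kL n))) ^ 2) := by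
        refine Real.sqrt_le_sqrt ?_
        unfold lamL
        nlinarith [Real.pi_pos, mul_pos Real.pi_pos Real.pi_pos, sq_nonneg (freqNormSq (kL n)),
          mul_nonneg (mul_pos Real.pi_pos Real.pi_pos).le hF]
    _ = 2 * Real.pi * (1 + freqNormSq (kL n)) := Real.sqrt_sq (by positivity)

/-- `∑_n g_n(ν) < ∞` for `ν > 0`. [folklore] -/
theorem summable_gradAmp {ν : ℝ} (hν : 0 < ν) :
    Summable fun n => Real.sqrt (lamL n) * ‖zL ν n‖ := by
  refine Summable.of_nonneg_of_le (fun n => mul_nonneg (Real.sqrt_nonneg _) (norm_nonneg _))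
    (fun n => ?_) (summable_zL_weight hν 1)
  rw [pow_one, mul_comm]
  exact mul_le_mul_of_nonneg_left (sqrt_lamL_le n) (norm_nonneg _)

/-- **Pointwise gradient bound**: `|∂ⱼR_ν(y)| ≤ ∑_n g_n(ν)` (termwise differentiation of the
mode series and `|M_k(z)| ≤ |z|`). [cite: Grafakos2014, Prop. 3.2.6 (8)] -/
theorem abs_partialDeriv_RL_le {ν : ℝ} (hν : 0 < ν) (j : Fin 2) (y : UnitAddTorus (Fin 2)) :
    |partialDeriv j (RL ν) y| ≤ ∑' n, (Real.sqrt (lamL n) * ‖zL ν n‖) := by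
  have h := (rapidDecay_zL hν).partialDeriv_modeSeries j y
  rw [RL, h, ← Real.norm_eq_abs]
  exact tsum_of_norm_bounded (summable_gradAmp hν).hasSum
    fun n => (norm_rmode_le _ _ _).trans (norm_deriv_coeff_le ν n j)

/-- `‖∇R_ν‖²_{L²} ≤ 2 (∑_n g_n(ν))²` (two components, unit volume). [folklore] -/
theorem scalarGradNormSq_RL_le {ν : ℝ} (hν : 0 < ν) :
    Torus.scalarGradNormSq (RL ν) ≤ 2 * (∑' n, (Real.sqrt (lamL n) * ‖zL ν n‖)) ^ 2 := by
  have hR := isSmooth_RL hν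
  rw [Torus.scalarGradNormSq_eq_sum_integral hR]
  have h1 : ∀ j : Fin 2,
      ∫ y, partialDeriv j (RL ν) y ^ 2 ≤ (∑' n, (Real.sqrt (lamL n) * ‖zL ν n‖)) ^ 2 := by
    intro j
    calc ∫ y, partialDeriv j (RL ν) y ^ 2
        ≤ ∫ _ : UnitAddTorus (Fin 2), (∑' n, (Real.sqrt (lamL n) * ‖zL ν n‖)) ^ 2 := by
          refine integral_mono ((hR.partialDeriv j).continuous.pow 2).integrable_unitAddTorus
            (integrable_const _) fun y => ?_
          have h := abs_partialDeriv_RL_le hν j y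
          have h0 : 0 ≤ ∑' n, (Real.sqrt (lamL n) * ‖zL ν n‖) :=
            tsum_nonneg fun n => mul_nonneg (Real.sqrt_nonneg _) (norm_nonneg _)
          calc partialDeriv j (RL ν) y ^ 2 = |partialDeriv j (RL ν) y| ^ 2 := (sq_abs _).symm
            _ ≤ (∑' n, (Real.sqrt (lamL n) * ‖zL ν n‖)) ^ 2 := pow_le_pow_left₀ (abs_nonneg _) h 2
      _ = (∑' n, (Real.sqrt (lamL n) * ‖zL ν n‖)) ^ 2 := by simp
  calc ∑ j : Fin 2, ∫ y, partialDeriv j (RL ν) y ^ 2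
      ≤ ∑ _j : Fin 2, (∑' n, (Real.sqrt (lamL n) * ‖zL ν n‖)) ^ 2 :=
        Finset.sum_le_sum fun j _ => h1 j
    _ = 2 * (∑' n, (Real.sqrt (lamL n) * ‖zL ν n‖)) ^ 2 := by simp [two_mul]

/-- **Uniform domination**: `√ν g_n(ν) ≤ √π 2^{-n}` for every `ν > 0`, i.e.
`νλ_n |z_n(ν)|² ≤ π 4^{-n}` (`|z_n| = w_n/|iσ_n + νλ_n|`, `w_n = |σ_n| 2^{-n}`,
`σ_n² + ν²λ_n² ≥ 2|σ_n| νλ_n`, `|σ_n| ≤ 2π`). [folklore] -/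
theorem sqrt_mul_gradAmp_le {ν : ℝ} (hν : 0 < ν) (n : ℕ) :
    Real.sqrt ν * (Real.sqrt (lamL n) * ‖zL ν n‖) ≤ Real.sqrt Real.pi * (1 / 2 : ℝ) ^ n := by
  have hσ0 : 0 < |σL n| := abs_pos.2 (σL_ne_zero n)
  have hσ : |σL n| ≤ 2 * Real.pi := by
    rw [abs_σL]; nlinarith [sL_lt_one n, sL_pos n, Real.pi_pos]
  have hlam := lamL_pos n
  have hden : ‖den ν n‖ ^ 2 = (ν * lamL n) ^ 2 + σL n ^ 2 := by
    rw [Complex.sq_norm, Complex.normSq_apply, den_re, den_im]; ring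
  have hdpos : 0 < ‖den ν n‖ := norm_pos_iff.2 (den_ne_zero ν n)
  have hz : ‖zL ν n‖ = |σL n| * (1 / 2 : ℝ) ^ n / ‖den ν n‖ := by
    rw [zL, norm_div, Complex.norm_real, Real.norm_eq_abs, abs_of_pos (wL_pos n), wL_eq]
  have h0l : 0 ≤ Real.sqrt ν * (Real.sqrt (lamL n) * ‖zL ν n‖) :=
    mul_nonneg (Real.sqrt_nonneg _) (mul_nonneg (Real.sqrt_nonneg _) (norm_nonneg _))
  have h0r : 0 ≤ Real.sqrt Real.pi * (1 / 2 : ℝ) ^ n := by positivity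
  rw [← pow_le_pow_iff_left₀ h0l h0r two_ne_zero]
  have hl : (Real.sqrt ν * (Real.sqrt (lamL n) * ‖zL ν n‖)) ^ 2 = ν * lamL n * ‖zL ν n‖ ^ 2 := by
    rw [mul_pow, mul_pow, Real.sq_sqrt hν.le, Real.sq_sqrt hlam.le]; ring
  have hr : (Real.sqrt Real.pi * (1 / 2 : ℝ) ^ n) ^ 2 = Real.pi * ((1 / 2 : ℝ) ^ n) ^ 2 := by
    rw [mul_pow, Real.sq_sqrt Real.pi_pos.le]
  rw [hl, hr, hz, div_pow, mul_pow, ← mul_div_assoc, div_le_iff₀ (pow_pos hdpos 2), hden]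
  -- `ν λ σ² q ≤ π q ((νλ)² + σ²)`, `q = 4^{-n}`: from `2|σ|νλ ≤ (νλ)² + σ²` and `|σ| ≤ 2π`.
  have hq : 0 ≤ ((1 / 2 : ℝ) ^ n) ^ 2 := by positivity
  have hσsq : σL n ^ 2 = |σL n| ^ 2 := (sq_abs _).symm
  have hamgm : 2 * |σL n| * (ν * lamL n) ≤ (ν * lamL n) ^ 2 + |σL n| ^ 2 := by
    nlinarith [sq_nonneg (ν * lamL n - |σL n|)]
  have hνl : 0 ≤ ν * lamL n := by positivity
  rw [hσsq]
  have key : ν * lamL n * |σL n| ^ 2 ≤ Real.pi * ((ν * lamL n) ^ 2 + |σL n| ^ 2) := by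
    nlinarith [mul_le_mul_of_nonneg_left hσ (mul_nonneg hνl hσ0.le), Real.pi_pos]
  nlinarith [mul_le_mul_of_nonneg_right key hq]

/-- **Termwise limit**: `√ν g_n(ν) → 0` as `ν → 0⁺` (`|z_n(ν)| ≤ 2^{-n}` uniformly). [folklore] -/
theorem tendsto_sqrt_mul_gradAmp (n : ℕ) :
    Tendsto (fun ν => Real.sqrt ν * (Real.sqrt (lamL n) * ‖zL ν n‖)) (𝓝[>] 0) (𝓝 0) := by
  have hs : Tendsto (fun ν : ℝ => Real.sqrt ν * (Real.sqrt (lamL n) * (1 / 2 : ℝ) ^ n))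
      (𝓝[>] 0) (𝓝 0) := by
    have h := ((Real.continuous_sqrt.tendsto (0 : ℝ)).mono_left
      (nhdsWithin_le_nhds (s := Ioi (0 : ℝ)))).mul_const (Real.sqrt (lamL n) * (1 / 2 : ℝ) ^ n)
    simpa using h
  refine squeeze_zero
    (fun ν => mul_nonneg (Real.sqrt_nonneg _) (mul_nonneg (Real.sqrt_nonneg _) (norm_nonneg _)))
    (fun ν => mul_le_mul_of_nonneg_left ?_ (Real.sqrt_nonneg _)) hs
  exact mul_le_mul_of_nonneg_left (norm_zL_le ν n) (Real.sqrt_nonneg _)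

/-- **Tannery**: `∑_n √ν g_n(ν) → 0` as `ν → 0⁺`. [folklore] -/
theorem tendsto_tsum_sqrt_mul_gradAmp :
    Tendsto (fun ν => ∑' n, Real.sqrt ν * (Real.sqrt (lamL n) * ‖zL ν n‖)) (𝓝[>] 0) (𝓝 0) := by
  have hb : Summable fun n : ℕ => Real.sqrt Real.pi * (1 / 2 : ℝ) ^ n :=
    (summable_geometric_of_lt_one (by norm_num) (by norm_num)).mul_left _
  have h := tendsto_tsum_of_dominated_convergence (𝓕 := 𝓝[>] (0 : ℝ))
    (f := fun ν n => Real.sqrt ν * (Real.sqrt (lamL n) * ‖zL ν n‖)) (g := fun _ => (0 : ℝ)) hb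
    tendsto_sqrt_mul_gradAmp
    (eventually_nhdsWithin_of_forall fun ν (hν : 0 < ν) n => by
      rw [Real.norm_eq_abs, abs_of_nonneg
        (mul_nonneg (Real.sqrt_nonneg _) (mul_nonneg (Real.sqrt_nonneg _) (norm_nonneg _)))]
      exact sqrt_mul_gradAmp_le hν n)
  simpa using h

/-- `ν ‖∇R_ν‖²_{L²} ≤ 2 (∑_n √ν g_n(ν))²` for `ν > 0`. [folklore] -/
theorem nu_mul_scalarGradNormSq_RL_le {ν : ℝ} (hν : 0 < ν) :
    ν * Torus.scalarGradNormSq (RL ν) ≤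
      2 * (∑' n, Real.sqrt ν * (Real.sqrt (lamL n) * ‖zL ν n‖)) ^ 2 := by
  rw [tsum_mul_left, mul_pow, Real.sq_sqrt hν.le]
  nlinarith [scalarGradNormSq_RL_le hν, sq_nonneg (∑' n, (Real.sqrt (lamL n) * ‖zL ν n‖))]

end Planar

/-! ## The three-dimensional states: vanishing dissipation -/

section ThreeD


/-- `‖∇U_ν‖₂² = ‖∇R_ν‖²_{L²}` (the drift is constant, `‖∇c‖₂² = 0`; `2½`-dimensional
dissipation split). [cite: Cheskidov2023, §6 p. 19] -/
theorem toReal_eGradNormSq_UL {ν : ℝ} (hν : 0 < ν) :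
    (eGradNormSq (UL ν)).toReal = Torus.scalarGradNormSq (RL ν) := by
  have h0 : gradNormSq (fun _ : UnitAddTorus (Fin 2) => cL) = 0 := by
    simp [gradNormSq, Torus.partialDeriv, Torus.lineDeriv]
  rw [UL, Torus.toReal_eGradNormSq_twoHalf (isSmooth_const cL) (isSmooth_RL hν), h0, zero_add]

/-- `ν ‖∇U_ν‖₂² ≤ 2 (∑_n √ν g_n(ν))²` for `ν > 0`. [folklore] -/
theorem dissipation_UL_le {ν : ℝ} (hν : 0 < ν) :
    ν * (eGradNormSq (UL ν)).toReal ≤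
      2 * (∑' n, Real.sqrt ν * (Real.sqrt (lamL n) * ‖zL ν n‖)) ^ 2 := by
  rw [toReal_eGradNormSq_UL hν]; exact nu_mul_scalarGradNormSq_RL_le hν

/-- **No anomalous dissipation in the Liouville class**: `ν ‖∇U_ν‖₂² → 0` as `ν → 0⁺`, over
the whole family of exact steady states under the fixed force `f`. [folklore] -/
theorem tendsto_dissipation_UL :
    Tendsto (fun ν => ν * (eGradNormSq (UL ν)).toReal) (𝓝[>] 0) (𝓝 0) := by
  have h2 : Tendsto (fun ν => 2 * (∑' n, Real.sqrt ν * (Real.sqrt (lamL n) * ‖zL ν n‖)) ^ 2)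
      (𝓝[>] 0) (𝓝 0) := by
    simpa using (tendsto_tsum_sqrt_mul_gradAmp.pow 2).const_mul (2 : ℝ)
  refine squeeze_zero' (eventually_nhdsWithin_of_forall fun ν (hν : 0 < ν) =>
      mul_nonneg hν.le ENNReal.toReal_nonneg)
    (eventually_nhdsWithin_of_forall fun ν (hν : 0 < ν) => dissipation_UL_le hν) h2

/-- Along the resonant viscosities (`ν_n → 0` within `(0, ∞)`): `ν_n ‖∇U_{ν_n}‖₂² → 0`
(while `‖∇U_{ν_n}‖₂² → ∞`, `tendsto_enstrophy`). [folklore] -/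
theorem tendsto_dissipation_νL :
    Tendsto (fun n => νL n * (eGradNormSq (UL (νL n))).toReal) atTop (𝓝 0) :=
  tendsto_dissipation_UL.comp (tendsto_nhdsWithin_iff.2 ⟨tendsto_νL, Eventually.of_forall νL_pos⟩)

/-! ## Main theorems -/

/-- **Unbounded enstrophy, vanishing dissipation, bounded energy, ONE smooth force (steady
states).**  There are a smooth, divergence-free, mean-zero force `f` on `T³`, viscosities
`ν_n > 0`, `ν_n → 0`, and smooth steady classical solutions `(U_n, P_n)` of `NS_{ν_n} + f` with
`sup_n ∫‖U_n‖² < ∞`, `‖∇U_n‖₂² → ∞` and `ν_n ‖∇U_n‖₂² → 0`. [folklore] -/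
theorem exists_steadyStates_unboundedEnstrophy_vanishingDissipation :
    ∃ f : UnitAddTorus (Fin 3) → EuclideanSpace ℝ (Fin 3),
      IsSmooth f ∧ IsDivFree f ∧ HasZeroMean f ∧
      ∃ (ν : ℕ → ℝ) (U : ℕ → UnitAddTorus (Fin 3) → EuclideanSpace ℝ (Fin 3))
        (P : ℕ → UnitAddTorus (Fin 3) → ℝ),
        (∀ n, 0 < ν n) ∧ Tendsto ν atTop (𝓝 0) ∧
        (∀ n, IsClassicalNSSolutionOn univ (ν n) (fun _ => f) (fun _ => U n) (fun _ => P n)) ∧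
        (∃ E : ℝ, ∀ n, ∫ x, ‖U n x‖ ^ 2 ≤ E) ∧
        Tendsto (fun n => (eGradNormSq (U n)).toReal) atTop atTop ∧
        Tendsto (fun n => ν n * (eGradNormSq (U n)).toReal) atTop (𝓝 0) :=
  ⟨fL, isSmooth_fL, isDivFree_fL, hasZeroMean_fL, νL, fun n => UL (νL n),
    fun _ => (fun _ : UnitAddTorus (Fin 2) => (0 : ℝ)) ∘ planarProj, νL_pos, tendsto_νL,
    fun n => isClassicalNSSolutionOn_UL (νL_pos n), ⟨_, fun n => integral_norm_sq_UL_le (νL_pos n)⟩,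
    tendsto_enstrophy, tendsto_dissipation_νL⟩

/-- **Unbounded mean enstrophy with vanishing mean dissipation (zeroth-law vocabulary).**  In the
exact vocabulary of `AnomalousDissipation` / `Literature.Turb.ZerothLaw`: one smooth steady force,
`ν_j → 0`, global Leray–Hopf solutions with `sup_j meanEnergy < ∞`, whose mean enstrophy
`meanDissipation(ν_j,u_j)/ν_j → ∞` while `meanDissipation(ν_j,u_j) → 0`.  So "unbounded mean
enstrophy at bounded mean energy under one smooth force" is strictly weaker than the zeroth law
within exact fixed-force Leray–Hopf families. [folklore] -/
theorem exists_lerayHopf_unboundedMeanEnstrophy_vanishingDissipation :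
    ∃ f : UnitAddTorus (Fin 3) → EuclideanSpace ℝ (Fin 3),
      IsSmooth f ∧ IsDivFree f ∧ HasZeroMean f ∧
      ∃ (ν : ℕ → ℝ) (u₀ : ℕ → UnitAddTorus (Fin 3) → EuclideanSpace ℝ (Fin 3))
        (u : ℕ → ℝ → UnitAddTorus (Fin 3) → EuclideanSpace ℝ (Fin 3)),
        (∀ j, 0 < ν j) ∧ Tendsto ν atTop (𝓝 0) ∧
        (∀ j, Torus.IsGlobalLerayHopf (ν j) (fun _ => f) (u₀ j) (u j)) ∧
        (∃ E : ℝ, ∀ j, meanEnergy (u j) ≤ E) ∧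
        Tendsto (fun j => meanDissipation (ν j) (u j) / ν j) atTop atTop ∧
        Tendsto (fun j => meanDissipation (ν j) (u j)) atTop (𝓝 0) := by
  obtain ⟨f, hf, hdiv, hmean, ν, U, P, hν, hν0, hsol, ⟨E, hE⟩, hgrow, hdiss⟩ :=
    exists_steadyStates_unboundedEnstrophy_vanishingDissipation
  have hmd : ∀ n, meanDissipation (ν n) (fun _ => U n) = ν n * (eGradNormSq (U n)).toReal :=
    fun n => by unfold meanDissipation; rw [longTimeAvgSup_of_eq_const fun t _ => rfl]
  refine ⟨f, hf, hdiv, hmean, ν, U, fun n _ => U n, hν, hν0, fun n => (hsol n).isGlobalLerayHopf,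
    ⟨E, fun n => ?_⟩, ?_, ?_⟩
  · rw [meanEnergy_eq_longTimeAvgSup, longTimeAvgSup_of_eq_const fun t _ => rfl]
    exact hE n
  · refine (tendsto_congr fun n => ?_).2 hgrow
    rw [hmd, mul_div_cancel_left₀ _ (hν n).ne']
  · exact (tendsto_congr hmd).2 hdiss

end ThreeD

end Summit.AnomalousDissipation.AnomalousDissipation.Theorems

end
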